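import Literature.Computability.AlgebraicComplexity.MS21ANFThm35LargeChar
import Literature.Computability.AlgebraicComplexity.MS21ANFStructureLemma
import HarnessLib

/-!
# Medini–Shpilka 2021, Thm 35 (`thm:pitRoanf`) — discharged in every characteristic

`theorem MS2021_thm_35_holds : MS2021_thm_35` — the typed literature statement
(`MS21DenseOrbitsHittingSets`): for `f₁ ∈ ANF_{Δ₁}^{GLaff_n(K)}`, `f₂ ∈ ANF_{Δ₂}^{GLaff_n(K)}` over ANY
field `K` with `f₁ - f₂ ≠ 0`, every uniform `(2·max{Δ₁,Δ₂}+7)`-independent polynomial map `G`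
satisfies `(f₁ - f₂) ∘ G ≠ 0`.

Assembly (cell `val-lit`, consortium of RULINGs (61)/(64)/(68)/(74)–(78); route of record = the
printed §5.2 argument run on the affine polynomial graded by the uniform map, with the printed
Lemma 5.13 replaced by the characteristic-free STRUCTURE LEMMA for `ANF_Δ ∘ M` (registry B36: the
printed Lemma 5.13 is false in characteristic `2`; second-order HASSE operators repair it)):
`MS2021_thm_35_of_structureLemma` (seat x5 g3, `MS21ANFThm35LargeChar`: Cases `Δ₁ ≠ Δ₂`, A, B2,
diagonal Lemma pitRoanfSame, per-field core, Hasse branch; Lemma 5.12 = seat p1 g5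
`anf_rigidity_of_support_subset`; Lemmas 5.14/5.15 = seat t24 g5
`bind₁_affSubst_sum_C_mul_pderiv_pderiv_anf_ne_zero`) applied to the structure lemma
`MS2021.anf_hstruct` (seat t18 g5, `MS21ANFStructureLemma` on `MS21ANFHasseStructure` /
`MS21ANFHasseBlockExtraction` / `MS21ANFHasseBlockLemmas` / `MS21MultilinearHasseLemmas`, and seat
t17 g5's quarter combinatorics `MS21ANFHasseQuarterStructure`).

Theorems only; no definitions, no new named facts (D-0026); net debt −1.  HONEST FRAMING: a 2021
published theorem, machine-checked over every field (the print states it "over 𝔽"); `VP ≠ VNP` is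
NOT proved and nothing in this file bears on it.

## References
* [MediniShpilka2021] D. Medini, A. Shpilka, *Hitting sets and reconstruction for dense orbits in
  VP_e and ΣΠΣ circuits*, CCC 2021 (LIPIcs 200:19) = arXiv:2102.05632: Thm 35 / ‹thm:pitRoanf›
  (CCC p.19:13; arXiv ‹pitSumOfRoanfThm› p0008:L29–30); proof §5.2 (p0030:L28–p0031:L24).
-/

noncomputable section

open MvPolynomial

namespace Literature.Computability.AlgebraicComplexity

open MS2021

/-- **[MS21, Thm 35] holds as typed, over every field.**
[cite: MediniShpilka2021, Thm 35 (CCC LIPIcs 200:19 p.19:13 = arXiv:2102.05632 ‹pitSumOfRoanfThm› p0008:L29-30); proof §5.2 (p0030:L28–p0031:L24)] -/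
theorem MS2021_thm_35_holds : MS2021_thm_35 :=
  MS2021_thm_35_of_structureLemma fun K _ Δ N hN h2 h11 => anf_hstruct K Δ N hN h2 h11

end Literature.Computability.AlgebraicComplexity

end
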